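import Mathlib
import HarnessLib
import Summits.NavierStokesRegularity.NavierStokesRegularity.Theorems.QuarterLogPincerThinCascadeDefs
import Summits.NavierStokesRegularity.NavierStokesRegularity.Theorems.QuarterLogPincerTypeIQuantSubcubicExpUnitScaleD
import Summits.NavierStokesRegularity.NavierStokesRegularity.Theorems.QuarterLogPincerTypeIQuantSubcubicExpRescaleTools

/-!
# Crux `QuarterLogPincer.TypeIQuantSubcubicExp` (stmt-NavierStokesRegularity-24077), line `thin_cascade`:
  STUB I1 `stub_uniformScaledEnergy : UniformScaledEnergy` — PROVED

Prover file (`--supports stmt-NavierStokesRegularity-24077`, lead prover ns-tc-p1 g3) landing the registered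
4th stub of the skeleton `Cruxes/TypeIQuantSubcubicExp/Lines/thin_cascade.lean` (v5, ns-idea-7; critic
idea-crit-7 option (b)) BY NAME with its registered signature: `UniformScaledEnergy` — for every Type-I
constant `M` there is `C = C(M)` such that every Tao-frame solution on `[0,T]` with the virtual Type-I bound
`‖u(t,x)‖ ≤ M (T+τ−t)^{-1/2}` has, at every centre `x` and scale `0 < r`, `r² ≤ T`, Seregin's scaled
quantities `A`, `E`, `D` at the final vertex bounded by `C`.

Proof (the classical slice-by-slice route): the unit-scale clauses `exists_unitScale_energy_bounds`
(`A`, `E`; `…UnitScale`) and `exists_unitScale_pressure_bound` (`D`; `…UnitScaleD`) — Tao's pressure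
normalisation, the classical local energy identity tested at the integer lattice of cut-offs, the slice
flux bound linear in the uniformly local energy with the Type-I weight (near field Calderón–Zygmund, far
field kernel representation + two-centre bound + uniformly local tail), the integral Gronwall lemma,
Fatou at the final time — are transported to the vertex `(T, x)` and the radius `r` by the Navier–Stokes
scaling `w = r • stPull (r²) r 0 x u`, `q = r² • stPull (r²) r 0 x p` (`…RescaleTools`): `A` and `E`
scale like `r`, `D` like `r²`.  `C(M) = B(M) + B_D(M)`.

HONEST FRAMING: this closes ONE registered stub (I1, "no wall") of an open crux; stubs S2
(`stub_thinObjectExtraction`) and S3 (`stub_thinCascadeLiouville`, the DSS wall) remain open; the crux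
`TypeIQuantSubcubicExp`, its parent `SuperlogCubeRate` and Navier–Stokes regularity are NOT proved; no
summit statement is proved by this file.
-/

noncomputable section

-- the summit-side namespace `Summit.NavierStokesRegularity.NavierStokesRegularity.…` (single-conjunct summit,
-- D-0017) repeats a component by design; the dupNamespace linter would flag every declaration.
set_option linter.dupNamespace false

namespace Summit.NavierStokesRegularity.NavierStokesRegularity.Cruxes.TypeIQuantSubcubicExp.ThinCascade

open MeasureTheory Set Function Metric Filter Topology
open scoped ENNReal NNReal
open Literature.Analysis Literature.Analysis.FluidPDE
open Summit.NavierStokesRegularity.NavierStokesRegularity.Theorems.ThinCascade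

/-- **STUB I1 of line `thin_cascade` (skeleton v5): uniform scaled energies from the Type-I rate
alone.**  For every `M` there is `C` such that every Tao frame `(T, u, p)` with the virtual Type-I bound
`‖u(t,x)‖ ≤ M (T+τ−t)^{-1/2}` (`τ > 0`) satisfies, at every centre `x` and radius `0 < r`, `r² ≤ T`:
`A`: `∫_{B(x,r)} ‖u(t)‖² ≤ C r` for `t ∈ [T−r², T]`; `E`: `∫_{[T−r²,T]} ∫_{B(x,r)} ‖∇u‖² ≤ C r`;
`D`: `∫_{[T−r²,T]} ∫_{B(x,r)} |p − ⨍_{B(x,r)} p(t)|^{3/2} ≤ C r²`.  Unit scale by the weighted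
`L²_uloc` Gronwall argument, general scale by the Navier–Stokes scaling. [folklore] -/
theorem stub_uniformScaledEnergy : UniformScaledEnergy := by
  obtain ⟨B, hB0, hAE⟩ := exists_unitScale_energy_bounds
  obtain ⟨BD, hBD0, hD⟩ := exists_unitScale_pressure_bound
  intro M
  refine ⟨B M + BD M, ?_⟩
  intro T τ u p hfr hτ hrate x r hr hrT
  -- ## the rescaled data at unit scale
  have hr2 : 0 < r ^ 2 := by positivity
  have hT' : 1 ≤ T / r ^ 2 := by rw [le_div_iff₀ hr2, one_mul]; exact hrT
  have hτ' : 0 < τ / r ^ 2 := div_pos hτ hr2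
  set w : ℝ → EuclideanSpace ℝ (Fin 3) → EuclideanSpace ℝ (Fin 3) := r • stPull (r ^ 2) r 0 x u with hw
  set q : ℝ → EuclideanSpace ℝ (Fin 3) → ℝ := r ^ 2 • stPull (r ^ 2) r 0 x p with hq
  have hclw : IsClassicalNSSolutionOn (Icc 0 (T / r ^ 2)) 1 0 w q := rescale_classical hr x hfr.1
  obtain ⟨E₀, hE₀, hE⟩ := exists_lintegral_sq_le_of_taoFrame hfr
  have hEw : ∃ E₁ : ℝ≥0∞, E₁ ≠ ⊤ ∧ ∀ s ∈ Icc 0 (T / r ^ 2), ∫⁻ y, ‖w s y‖ₑ ^ 2 ≤ E₁ :=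
    rescale_lintegral_sq hr x hE₀ hE
  have hratew : ∀ s ∈ Icc 0 (T / r ^ 2), ∀ y,
      ‖w s y‖ ≤ M * (T / r ^ 2 + τ / r ^ 2 - s) ^ (-(1 / 2 : ℝ)) := rescale_rate hr hτ x hrate
  have hAEw := hAE hclw hEw hτ' hratew hT' (0 : EuclideanSpace ℝ (Fin 3))
  have hDw := hD hclw hEw hτ' hratew hT' (0 : EuclideanSpace ℝ (Fin 3))
  -- ## elementary conversions
  have hofr0 : ENNReal.ofReal r ≠ 0 := (ENNReal.ofReal_pos.2 hr).ne'
  have hofr2 : ENNReal.ofReal (r ^ 2) ≠ 0 := (ENNReal.ofReal_pos.2 hr2).ne'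
  have htime : ∀ {t : ℝ}, t ∈ Icc (T - r ^ 2) T → t / r ^ 2 ∈ Icc (T / r ^ 2 - 1) (T / r ^ 2) := by
    intro t ht
    constructor
    · rw [show T / r ^ 2 - 1 = (T - r ^ 2) / r ^ 2 by field_simp]
      exact div_le_div_of_nonneg_right ht.1 hr2.le
    · exact div_le_div_of_nonneg_right ht.2 hr2.le
  have hts : ∀ t : ℝ, 0 + r ^ 2 * (t / r ^ 2) = t := fun t => by field_simp; ring
  have hwin : Icc (r ^ 2 * (T / r ^ 2 - 1)) (r ^ 2 * (T / r ^ 2)) = Icc (T - r ^ 2) T := by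
    congr 1 <;> field_simp
  have hCr : ENNReal.ofReal r * ENNReal.ofReal (B M) ≤ ENNReal.ofReal ((B M + BD M) * r) := by
    rw [← ENNReal.ofReal_mul hr.le]
    exact ENNReal.ofReal_le_ofReal (by nlinarith [hB0 M, hBD0 M])
  refine ⟨?_, ?_, ?_⟩
  · -- ### clause A
    intro t ht
    have h1 := hAEw.1 (t / r ^ 2) (htime ht)
    rw [hw, lintegral_sq_ball_zoom hr 0 x u (t / r ^ 2) 0 1, smul_zero, add_zero, mul_one, hts,
      ENNReal.inv_mul_le_iff hofr0 ENNReal.ofReal_ne_top] at h1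
    calc ∫⁻ y in ball x r, ENNReal.ofReal (‖u t y‖ ^ 2)
        = ∫⁻ y in ball x r, ‖u t y‖ₑ ^ 2 := by
          refine lintegral_congr fun y => ?_
          rw [ENNReal.ofReal_pow (norm_nonneg _), ofReal_norm]
      _ ≤ ENNReal.ofReal r * ENNReal.ofReal (B M) := h1
      _ ≤ _ := hCr
  · -- ### clause E
    set H : ℝ → ℝ≥0∞ := fun t => ∫⁻ y in ball x r, ENNReal.ofReal (‖fderiv ℝ (u t) y‖ ^ 2) with hH
    -- the inner integral of the rescaled field
    have hinner : ∀ s ∈ Icc (T / r ^ 2 - 1) (T / r ^ 2),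
        ∫⁻ y in ball (0 : EuclideanSpace ℝ (Fin 3)) 1, ENNReal.ofReal (‖fderiv ℝ (w s) y‖ ^ 2) =
          ENNReal.ofReal r * H (r ^ 2 * s) := by
      intro s hs
      have hgrad : ∀ y, fderiv ℝ (w s) y = r • (r • fderiv ℝ (u (0 + r ^ 2 * s)) (x + r • y)) := by
        intro y
        rw [hw, show (r • stPull (r ^ 2) r 0 x u) s = r • (stPull (r ^ 2) r 0 x u s) from rfl,
          fderiv_const_smul_field, Pi.smul_apply, fderiv_stPull]
      have e : ∀ y, ENNReal.ofReal (‖fderiv ℝ (w s) y‖ ^ 2) =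
          ENNReal.ofReal (r ^ 4) * (fun z => ENNReal.ofReal (‖fderiv ℝ (u (r ^ 2 * s)) z‖ ^ 2))
            (x + r • y) := by
        intro y
        rw [hgrad y, norm_smul, norm_smul, Real.norm_of_nonneg hr.le, zero_add,
          ← ENNReal.ofReal_mul (by positivity)]
        congr 1
        ring
      simp_rw [e]
      have hsub := setLIntegral_ball_comp_add_smul
        (fun z => ENNReal.ofReal (‖fderiv ℝ (u (r ^ 2 * s)) z‖ ^ 2)) hr x 1
      simp only [mul_one] at hsub
      rw [lintegral_const_mul' _ _ ENNReal.ofReal_ne_top, hsub, ← mul_assoc,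
        ← ENNReal.ofReal_mul (by positivity)]
      congr 1
      rw [show r ^ 4 * (r ^ 3)⁻¹ = r by field_simp]
    have h2 := hAEw.2
    rw [setLIntegral_congr_fun measurableSet_Icc hinner, lintegral_const_mul' _ _ ENNReal.ofReal_ne_top,
      setLIntegral_Icc_comp_mul H hr2, hwin, ← mul_assoc, ← ENNReal.ofReal_mul hr.le,
      show r * (r ^ 2)⁻¹ = r⁻¹ by field_simp, ENNReal.ofReal_inv_of_pos hr,
      ENNReal.inv_mul_le_iff hofr0 ENNReal.ofReal_ne_top] at h2
    exact h2.trans hCr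
  · -- ### clause D
    set Dp : ℝ → ℝ≥0∞ := fun t => ∫⁻ y in ball x r,
      ENNReal.ofReal (|p t y - ⨍ z in ball x r, p t z| ^ (3 / 2 : ℝ)) with hDp
    have hinner : ∀ s ∈ Icc (T / r ^ 2 - 1) (T / r ^ 2),
        ∫⁻ y in ball (0 : EuclideanSpace ℝ (Fin 3)) 1,
            ENNReal.ofReal (|q s y - ⨍ z in ball (0 : EuclideanSpace ℝ (Fin 3)) 1, q s z| ^ (3 / 2 : ℝ)) =
          Dp (r ^ 2 * s) := by
      intro s hs
      -- the mean of the rescaled pressure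
      have hqval : ∀ y, q s y = r ^ 2 * p (r ^ 2 * s) (x + r • y) := fun y => by
        rw [hq, smul_stPull_apply, smul_eq_mul, zero_add]
      have hmean : ⨍ z in ball (0 : EuclideanSpace ℝ (Fin 3)) 1, q s z =
          r ^ 2 * ⨍ z in ball x r, p (r ^ 2 * s) z := by
        simp_rw [hqval]
        rw [← setAverage_ball_comp_add_smul (p (r ^ 2 * s)) hr x]
        simp only [setAverage_eq, integral_const_mul, smul_eq_mul]
        try ring
      have e : ∀ y, ENNReal.ofReal (|q s y - ⨍ z in ball (0 : EuclideanSpace ℝ (Fin 3)) 1, q s z| ^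
          (3 / 2 : ℝ)) = ENNReal.ofReal (r ^ 3) * (fun z => ENNReal.ofReal
            (|p (r ^ 2 * s) z - ⨍ z' in ball x r, p (r ^ 2 * s) z'| ^ (3 / 2 : ℝ))) (x + r • y) := by
        intro y
        rw [hmean, hqval, ← mul_sub, abs_mul, abs_of_pos hr2,
          Real.mul_rpow hr2.le (abs_nonneg _), ← ENNReal.ofReal_mul (by positivity)]
        congr 2
        rw [show (r ^ 2 : ℝ) = r ^ (2 : ℝ) by norm_cast, ← Real.rpow_mul hr.le]
        norm_num
      simp_rw [e]
      have hsub := setLIntegral_ball_comp_add_smul (fun z => ENNReal.ofReal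
        (|p (r ^ 2 * s) z - ⨍ z' in ball x r, p (r ^ 2 * s) z'| ^ (3 / 2 : ℝ))) hr x 1
      simp only [mul_one] at hsub
      rw [lintegral_const_mul' _ _ ENNReal.ofReal_ne_top, hsub, ← mul_assoc,
        ← ENNReal.ofReal_mul (by positivity), show r ^ 3 * (r ^ 3)⁻¹ = 1 by field_simp,
        ENNReal.ofReal_one, one_mul]
    have h3 := hDw
    rw [setLIntegral_congr_fun measurableSet_Icc hinner, setLIntegral_Icc_comp_mul Dp hr2, hwin,
      ENNReal.ofReal_inv_of_pos hr2, ENNReal.inv_mul_le_iff hofr2 ENNReal.ofReal_ne_top] at h3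
    calc ∫⁻ t in Icc (T - r ^ 2) T, Dp t ≤ ENNReal.ofReal (r ^ 2) * ENNReal.ofReal (BD M) := h3
      _ ≤ ENNReal.ofReal ((B M + BD M) * r ^ 2) := by
          rw [← ENNReal.ofReal_mul hr2.le]
          exact ENNReal.ofReal_le_ofReal (by nlinarith [hB0 M, hBD0 M])

end Summit.NavierStokesRegularity.NavierStokesRegularity.Cruxes.TypeIQuantSubcubicExp.ThinCascade

end
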